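import Literature.Geometry.Riemannian.VarianceMonotoneOfBarrier
import Literature.Geometry.Riemannian.DirectionalBarrierMinimumPrinciple
import Literature.Geometry.Riemannian.HeatPropagationSpaceTime
import Literature.Geometry.Riemannian.HeatKernelMeasures
import Literature.MeasureTheory.Integral.IteratedIntegralDiracLimit
import Literature.Geometry.Riemannian.RicciFlowDistanceContinuity
import Literature.Topology.StoneWeierstrassProduct
import HarnessLib

/-!
# Bamler 2020a, Cor. 3.6 for two heat kernel measures, from the DIRECTIONAL form of the
# distance-distortion estimate (the shape delivered by the second variation of arc length)

Companion of `VarianceMonotoneOfBarrier.lean` (function barriers). Here the hypothesis on `d_t²`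
is the directional datum of `directional_barrier_minimum_principle`
(`DirectionalBarrierMinimumPrinciple.lean`): orthonormal frames at `x` and `y`, one-variable
polynomial upper barriers along the geodesic directions, a left time barrier, and
`p − Σbˣ − Σbʸ ≥ −H − η` — exactly what `IsRicciFlow.distSq_directional_datum`
(`DistSqDirectionalDatum.lean`) PROVES for compact Ricci flows. The proof is that of
`IsRicciFlow.kernel_integral_integral_distSq_sub_ge_of_barrier` verbatim (smooth tensor
approximation of `d_{t₁}²`, tensor heat flow `U = Σ (Pαᵢ)(Pβᵢ)`, comparison, reproduction), with
the directional minimum principle in place of the barrier one: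

* `IsRicciFlow.kernel_integral_integral_distSq_sub_ge_of_directional` —
  `∫∫ d_{t₂}² dν_{x₂,t₀;t₂} dν_{x₁,t₀;t₂} − ∫∫ d_{t₁}² dν_{x₂,t₀;t₁} dν_{x₁,t₀;t₁} ≥ −H (t₂ − t₁)`.

Everything is proved; no definitions, no named facts.

## References

* R. H. Bamler, *Entropy and heat kernel bounds on a Ricci flow background*, arXiv:2008.07093
  (2020), §3, Thm. 3.5, Cor. 3.6. [Bamler2020Entropy]
-/

noncomputable section

open Bundle Set Function Filter Manifold MeasureTheory Measure TopologicalSpace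
open scoped Manifold ContDiff Topology ENNReal NNReal

namespace Literature.Geometry.Riemannian

open Lorentzian Lorentzian.PseudoRiemannianMetric Literature.Topology

section Directional

variable {m : ℕ} {H : Type*} [TopologicalSpace H]
  {I : ModelWithCorners ℝ (EuclideanSpace ℝ (Fin m)) H} [I.Boundaryless]
  {M : Type*} [TopologicalSpace M] [ChartedSpace H M] [IsManifold I ∞ M]
  [T2Space M] [CompactSpace M] [SecondCountableTopology M] [MeasurableSpace M] [BorelSpace M]
  {h : ℝ → PseudoRiemannianMetric I ∞ (EuclideanSpace ℝ (Fin m)) (TangentSpace I : M → Type _)}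
  (hh : IsContMDiffFamilyOn ∞ h univ) (hR : ∀ r, (h r).IsRiemannian)

variable {cov : ℝ → CovariantDerivative I (EuclideanSpace ℝ (Fin m)) (TangentSpace I : M → Type _)}

/-- **Cor. 3.6 of Bamler 2020a for two heat kernel measures, from the DIRECTIONAL form of
Thm. 3.5.**
For a `C^∞` family `h` of Riemannian metrics on a closed connected manifold which is a Ricci flow
on `[a, T]`, base time `t₀ ∈ (a, T]`, points `x₁, x₂`, and `a < t₁ < t₂ < t₀`: if at every
`(x, y, t)`, `t ∈ (t₁, t₂]`, and for every `η > 0` the function `d_t²(x, y)` admits an upper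
barrier near `(x, y, t)`, touching at the point, with `C²` slices and
`∂ₜb − Δ_x b − Δ_y b ≥ −H − η` there, then
`∫∫ d_{t₂}² dν_{x₂,t₀;t₂} dν_{x₁,t₀;t₂} − ∫∫ d_{t₁}² dν_{x₂,t₀;t₁} dν_{x₁,t₀;t₁} ≥ −H (t₂ − t₁)`.
[cite: Bamler2020Entropy, §3, Cor. 3.6] -/
theorem IsRicciFlow.kernel_integral_integral_distSq_sub_ge_of_directional [ConnectedSpace M]
    [∀ r, (h r).HasLeviCivita]
    {a T : ℝ} (hflow : IsRicciFlow h cov (Icc a T)) {t₀ : ℝ} (ht₀ : t₀ ∈ Ioc a T) (x₁ x₂ : M)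
    {t₁ t₂ : ℝ} (hat₁ : a < t₁) (h12 : t₁ < t₂) (h2 : t₂ < t₀) {Hc : ℝ}
    (hbar : ∀ x y, ∀ t ∈ Ioc t₁ t₂, ∀ η > 0,
      ∃ (ex : Fin (Module.finrank ℝ (EuclideanSpace ℝ (Fin m))) → TangentSpace I x)
        (ey : Fin (Module.finrank ℝ (EuclideanSpace ℝ (Fin m))) → TangentSpace I y)
        (Bx Bx' By By' : Fin (Module.finrank ℝ (EuclideanSpace ℝ (Fin m))) → ℝ → ℝ)
        (bx by_ : Fin (Module.finrank ℝ (EuclideanSpace ℝ (Fin m))) → ℝ) (Bt : ℝ → ℝ) (p : ℝ),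
        (∀ i j, (h t).val x (ex i) (ex j) = if i = j then 1 else 0) ∧
        (∀ i j, (h t).val y (ey i) (ey j) = if i = j then 1 else 0) ∧
        (∀ i, (∀ᶠ σ in 𝓝 (0 : ℝ), HasDerivAt (Bx i) (Bx' i σ) σ) ∧ HasDerivAt (Bx' i) (bx i) 0 ∧
          Bx i 0 = ((h t).edist (hR t) x y).toReal ^ 2 ∧
          ∀ᶠ σ in 𝓝 (0 : ℝ), ((h t).edist (hR t) (expMap (h t).leviCivita x (σ • ex i)) y).toReal ^ 2 ≤
            Bx i σ) ∧
        (∀ i, (∀ᶠ σ in 𝓝 (0 : ℝ), HasDerivAt (By i) (By' i σ) σ) ∧ HasDerivAt (By' i) (by_ i) 0 ∧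
          By i 0 = ((h t).edist (hR t) x y).toReal ^ 2 ∧
          ∀ᶠ σ in 𝓝 (0 : ℝ), ((h t).edist (hR t) x (expMap (h t).leviCivita y (σ • ey i))).toReal ^ 2 ≤
            By i σ) ∧
        (HasDerivWithinAt Bt p (Iic t) t ∧ Bt t = ((h t).edist (hR t) x y).toReal ^ 2 ∧
          ∀ᶠ t' in 𝓝[<] t, ((h t').edist (hR t') x y).toReal ^ 2 ≤ Bt t') ∧
        -Hc - η ≤ p - ∑ i, bx i - ∑ i, by_ i) :
    -Hc * (t₂ - t₁) ≤
      (∫ y₁, ∫ y₂, ((h t₂).edist (hR t₂) y₁ y₂).toReal ^ 2 ∂(heatKernelMeasure hh hR t₀ x₂ t₂)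
          ∂(heatKernelMeasure hh hR t₀ x₁ t₂)) -
        ∫ y₁, ∫ y₂, ((h t₁).edist (hR t₁) y₁ y₂).toReal ^ 2 ∂(heatKernelMeasure hh hR t₀ x₂ t₁)
          ∂(heatKernelMeasure hh hR t₀ x₁ t₁) := by
  -- notation
  set d : M → M → ℝ → ℝ := fun x y t ↦ ((h t).edist (hR t) x y).toReal ^ 2 with hd
  set ν₁ : ℝ → Measure M := fun r ↦ heatKernelMeasure hh hR t₀ x₁ r with hν₁
  set ν₂ : ℝ → Measure M := fun r ↦ heatKernelMeasure hh hR t₀ x₂ r with hν₂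
  haveI hP₁ : ∀ r, IsProbabilityMeasure (ν₁ r) := fun r ↦ by
    simp only [hν₁]; infer_instance
  haveI hP₂ : ∀ r, IsProbabilityMeasure (ν₂ r) := fun r ↦ by
    simp only [hν₂]; infer_instance
  have hdc : ∀ r, Continuous fun q : M × M ↦ d q.1 q.2 r := fun r ↦
    (ENNReal.continuousOn_toReal.comp_continuous (PseudoRiemannianMetric.continuous_edist (hR r))
      fun p ↦ PseudoRiemannianMetric.edist_ne_top (hR r) p.1 p.2).pow 2
  have hflow' : IsRicciFlow h cov (Icc t₁ t₂) :=
    hflow.mono (Icc_subset_Icc hat₁.le (h2.le.trans ht₀.2))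
  have hdcont : ContinuousOn (fun p : M × M × ℝ ↦ d p.1 p.2.1 p.2.2) (univ ×ˢ univ ×ˢ Icc t₁ t₂) :=
    (hflow'.continuousOn_edist_toReal_family h12.le hR).pow 2
  -- integrability of continuous functions against the (probability) kernel measures
  have hint : ∀ {f : M → ℝ}, Continuous f → ∀ (ρ : Measure M) [IsFiniteMeasure ρ], Integrable f ρ :=
    fun hf ρ _ ↦ hf.integrable_of_hasCompactSupport (HasCompactSupport.of_compactSpace _)
  -- it suffices to prove the bound up to `2η` for every `η > 0`
  suffices hη : ∀ η > 0, -Hc * (t₂ - t₁) ≤ (∫ y₁, ∫ y₂, d y₁ y₂ t₂ ∂ν₂ t₂ ∂ν₁ t₂) -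
      (∫ y₁, ∫ y₂, d y₁ y₂ t₁ ∂ν₂ t₁ ∂ν₁ t₁) + 2 * η by
    refine le_of_forall_pos_le_add fun ε hε ↦ ?_
    have := hη (ε / 2) (half_pos hε)
    linarith
  intro η hη
  ----------------------------------------------------------------
  -- Step 1: smooth tensor approximation of `d_{t₁}²`
  ----------------------------------------------------------------
  obtain ⟨n, α, β, hαs, hβs, happrox⟩ := exists_smooth_sum_mul_near (I := I) (hdc t₁) hη
  ----------------------------------------------------------------
  -- Step 2: the tensor heat flow `U = Σ (P αᵢ)(x,t) (P βᵢ)(y,t)` from time `t₁`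
  ----------------------------------------------------------------
  set A : Fin n → M → ℝ → ℝ := fun i x t ↦ heatValue h t₁ t x (α i) with hA
  set B : Fin n → M → ℝ → ℝ := fun i y t ↦ heatValue h t₁ t y (β i) with hB
  set U : M → M → ℝ → ℝ := fun x y t ↦ ∑ i, A i x t * B i y t with hU
  -- regularity of the factors
  have hAs : ∀ i, ContMDiffOn (I.prod 𝓘(ℝ, ℝ)) 𝓘(ℝ, ℝ) ∞ (fun p : M × ℝ ↦ A i p.1 p.2) (univ ×ˢ Ici t₁) :=
    fun i ↦ contMDiffOn_heatValue_spaceTime hh hR t₁ (hαs i)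
  have hBs : ∀ i, ContMDiffOn (I.prod 𝓘(ℝ, ℝ)) 𝓘(ℝ, ℝ) ∞ (fun p : M × ℝ ↦ B i p.1 p.2) (univ ×ˢ Ici t₁) :=
    fun i ↦ contMDiffOn_heatValue_spaceTime hh hR t₁ (hβs i)
  have hAx : ∀ i, ∀ t ∈ Ici t₁, ContMDiff I 𝓘(ℝ, ℝ) ∞ fun x ↦ A i x t := fun i t ht ↦
    contMDiff_slice_of_contMDiffOn (u := fun t x ↦ A i x t) (hAs i) ht
  have hBy : ∀ i, ∀ t ∈ Ici t₁, ContMDiff I 𝓘(ℝ, ℝ) ∞ fun y ↦ B i y t := fun i t ht ↦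
    contMDiff_slice_of_contMDiffOn (u := fun t y ↦ B i y t) (hBs i) ht
  have hAt : ∀ i x, ∀ t, t₁ < t → HasDerivAt (fun s ↦ A i x s)
      ((h t).laplaceBeltrami (fun x' ↦ A i x' t) x) t := fun i x t ht ↦
    hasDerivAt_heatValue hh hR ht (hαs i) x
  have hBt : ∀ i y, ∀ t, t₁ < t → HasDerivAt (fun s ↦ B i y s)
      ((h t).laplaceBeltrami (fun y' ↦ B i y' t) y) t := fun i y t ht ↦
    hasDerivAt_heatValue hh hR ht (hβs i) y
  have h2le : (2 : ℕ∞ω) ≤ (∞ : ℕ∞ω) := WithTop.coe_le_coe.mpr le_top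
  -- the hypotheses of the minimum principle for `U`
  have hUx : ∀ y, ∀ t ∈ Ioc t₁ t₂, ContMDiff I 𝓘(ℝ, ℝ) 2 fun x ↦ U x y t := by
    intro y t ht
    have : ContMDiff I 𝓘(ℝ, ℝ) 2 fun x ↦ ∑ i ∈ Finset.univ, A i x t * B i y t :=
      ContMDiff.sum fun i _ ↦ (((hAx i t (le_of_lt ht.1)).of_le h2le).mul contMDiff_const :
        ContMDiff I 𝓘(ℝ, ℝ) 2 fun x ↦ A i x t * B i y t)
    simpa only [hU] using this
  have hUy : ∀ x, ∀ t ∈ Ioc t₁ t₂, ContMDiff I 𝓘(ℝ, ℝ) 2 fun y ↦ U x y t := by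
    intro x t ht
    have : ContMDiff I 𝓘(ℝ, ℝ) 2 fun y ↦ ∑ i ∈ Finset.univ, A i x t * B i y t :=
      ContMDiff.sum fun i _ ↦ (contMDiff_const.mul ((hBy i t (le_of_lt ht.1)).of_le h2le) :
        ContMDiff I 𝓘(ℝ, ℝ) 2 fun y ↦ A i x t * B i y t)
    simpa only [hU] using this
  have hLx : ∀ x y, ∀ t ∈ Ioc t₁ t₂, (h t).laplaceBeltrami (fun x' ↦ U x' y t) x =
      ∑ i, B i y t * (h t).laplaceBeltrami (fun x' ↦ A i x' t) x := by
    intro x y t ht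
    have e : (fun x' ↦ U x' y t) = fun x' ↦ ∑ i, B i y t * A i x' t := by
      funext x'; simp only [hU]; exact Finset.sum_congr rfl fun i _ ↦ mul_comm _ _
    rw [e]
    exact laplaceBeltrami_finset_sum_mul Finset.univ (h t)
      (fun i ↦ ((hAx i t (le_of_lt ht.1)).of_le h2le) x) _
  have hLy : ∀ x y, ∀ t ∈ Ioc t₁ t₂, (h t).laplaceBeltrami (fun y' ↦ U x y' t) y =
      ∑ i, A i x t * (h t).laplaceBeltrami (fun y' ↦ B i y' t) y := by
    intro x y t ht
    exact laplaceBeltrami_finset_sum_mul Finset.univ (h t)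
      (fun i ↦ ((hBy i t (le_of_lt ht.1)).of_le h2le) y) _
  have hUt : ∀ x y, ∀ t ∈ Ioc t₁ t₂, HasDerivAt (fun s ↦ U x y s)
      ((h t).laplaceBeltrami (fun x' ↦ U x' y t) x + (h t).laplaceBeltrami (fun y' ↦ U x y' t) y) t := by
    intro x y t ht
    rw [hLx x y t ht, hLy x y t ht, ← Finset.sum_add_distrib]
    have := HasDerivAt.fun_sum (u := Finset.univ) (A := fun i s ↦ A i x s * B i y s)
      (A' := fun i ↦ (h t).laplaceBeltrami (fun x' ↦ A i x' t) x * B i y t +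
        A i x t * (h t).laplaceBeltrami (fun y' ↦ B i y' t) y) (x := t)
      fun i _ ↦ (hAt i x t ht.1).mul (hBt i y t ht.1)
    have e : ∑ i, (B i y t * (h t).laplaceBeltrami (fun x' ↦ A i x' t) x +
        A i x t * (h t).laplaceBeltrami (fun y' ↦ B i y' t) y) =
        ∑ i, ((h t).laplaceBeltrami (fun x' ↦ A i x' t) x * B i y t +
          A i x t * (h t).laplaceBeltrami (fun y' ↦ B i y' t) y) :=
      Finset.sum_congr rfl fun i _ ↦ by ring
    rw [e]
    simpa only [hU] using this
  have hUc : ContinuousOn (fun p : M × M × ℝ ↦ U p.1 p.2.1 p.2.2) (univ ×ˢ univ ×ˢ Icc t₁ t₂) := by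
    simp only [hU]
    refine continuousOn_finsetSum _ fun i _ ↦ ContinuousOn.mul ?_ ?_
    · exact (hAs i).continuousOn.comp (continuous_fst.prodMk (continuous_snd.comp continuous_snd)).continuousOn
        fun p hp ↦ ⟨mem_univ _, hp.2.2.1⟩
    · exact (hBs i).continuousOn.comp ((continuous_fst.comp continuous_snd).prodMk
        (continuous_snd.comp continuous_snd)).continuousOn fun p hp ↦ ⟨mem_univ _, hp.2.2.1⟩
  have hU0 : ∀ x y, U x y t₁ = ∑ i, α i x * β i y := by
    intro x y
    simp only [hU, hA, hB, heatValue_of_le le_rfl]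
  ----------------------------------------------------------------
  -- Step 3: the comparison `U ≤ d² + η + H (t − t₁)` (barrier minimum principle)
  ----------------------------------------------------------------
  have hcomp := directional_barrier_minimum_principle (h := h) hR (ψ := fun x y t ↦ d x y t + η)
    (U := U) (hdcont.add continuousOn_const) hUc hUx hUy hUt (c := Hc) ?_ ?_
  rotate_left
  · -- the datum for `d² + η`: shift the given data by `η`
    intro x y t ht η' hη'
    obtain ⟨ex, ey, Bx, Bx', By, By', bx, by_, Bt, p, hexon, heyon, hBx, hBy, ⟨hBt, hBt0, hBtdom⟩, hineq⟩ :=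
      hbar x y t ht η' hη'
    refine ⟨ex, ey, fun i σ ↦ Bx i σ + η, Bx', fun i σ ↦ By i σ + η, By', bx, by_, fun t' ↦ Bt t' + η, p,
      hexon, heyon, fun i ↦ ?_, fun i ↦ ?_, ⟨hBt.add_const η, by simp only [hBt0, hd], ?_⟩, hineq⟩
    · obtain ⟨h1, h2', h3, h4⟩ := hBx i
      refine ⟨?_, h2', by simp only [h3, hd], ?_⟩
      · filter_upwards [h1] with σ hσ using hσ.add_const η
      · filter_upwards [h4] with σ hσ
        simp only [hd] at hσ ⊢
        linarith
    · obtain ⟨h1, h2', h3, h4⟩ := hBy i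
      refine ⟨?_, h2', by simp only [h3, hd], ?_⟩
      · filter_upwards [h1] with σ hσ using hσ.add_const η
      · filter_upwards [h4] with σ hσ
        simp only [hd] at hσ ⊢
        linarith
    · filter_upwards [hBtdom] with t' ht'
      simp only [hd] at ht' ⊢
      linarith
  · -- initial comparison `U(t₁) = Σ αᵢ βᵢ ≤ d_{t₁}² + η`
    intro x y
    rw [hU0]
    have := happrox (x, y)
    simp only [hd] at this ⊢
    linarith [(abs_lt.1 this).1]
  ----------------------------------------------------------------
  -- Step 4: integrate at time `t₂` and use the reproduction formula
  ----------------------------------------------------------------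
  have ht₂ : t₂ ∈ Icc t₁ t₂ := right_mem_Icc.2 h12.le
  have ht₂' : t₂ ∈ Ioc t₁ t₂ := ⟨h12, le_rfl⟩
  -- `∫∫ U(t₂) dν₂ dν₁ ≤ ∫∫ d_{t₂}² dν₂ dν₁ + η + H (t₂ − t₁)`
  have hUle : ∀ x y, U x y t₂ ≤ d x y t₂ + (η + Hc * (t₂ - t₁)) := fun x y ↦ by
    have := hcomp x y t₂ ht₂; linarith
  have hUc₂ : Continuous fun q : M × M ↦ U q.1 q.2 t₂ :=
    hUc.comp_continuous (continuous_fst.prodMk (continuous_snd.prodMk continuous_const))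
      fun q ↦ ⟨mem_univ _, mem_univ _, ht₂⟩
  have hI1 : ∫ y₁, ∫ y₂, U y₁ y₂ t₂ ∂ν₂ t₂ ∂ν₁ t₂ ≤
      (∫ y₁, ∫ y₂, d y₁ y₂ t₂ ∂ν₂ t₂ ∂ν₁ t₂) + (η + Hc * (t₂ - t₁)) := by
    have inner : ∀ y₁, ∫ y₂, U y₁ y₂ t₂ ∂ν₂ t₂ ≤ (∫ y₂, d y₁ y₂ t₂ ∂ν₂ t₂) + (η + Hc * (t₂ - t₁)) := by
      intro y₁
      have hId : Integrable (fun y₂ ↦ d y₁ y₂ t₂) (ν₂ t₂) :=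
        hint ((hdc t₂).comp (Continuous.prodMk_right y₁)) _
      calc ∫ y₂, U y₁ y₂ t₂ ∂ν₂ t₂ ≤ ∫ y₂, d y₁ y₂ t₂ + (η + Hc * (t₂ - t₁)) ∂ν₂ t₂ :=
            integral_mono (hint (hUc₂.comp (Continuous.prodMk_right y₁)) _)
              (hId.add (integrable_const _)) fun y₂ ↦ hUle y₁ y₂
        _ = (∫ y₂, d y₁ y₂ t₂ ∂ν₂ t₂) + (η + Hc * (t₂ - t₁)) := by
            rw [integral_add hId (integrable_const _), integral_const, probReal_univ, one_smul]
    have hG : Continuous fun y₁ ↦ ∫ y₂, d y₁ y₂ t₂ ∂ν₂ t₂ :=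
      Literature.MeasureTheory.Integral.continuous_integral_of_continuous_prod (ν₂ t₂) (hdc t₂)
    have hGU : Continuous fun y₁ ↦ ∫ y₂, U y₁ y₂ t₂ ∂ν₂ t₂ :=
      Literature.MeasureTheory.Integral.continuous_integral_of_continuous_prod (ν₂ t₂) hUc₂
    calc ∫ y₁, ∫ y₂, U y₁ y₂ t₂ ∂ν₂ t₂ ∂ν₁ t₂
        ≤ ∫ y₁, (∫ y₂, d y₁ y₂ t₂ ∂ν₂ t₂) + (η + Hc * (t₂ - t₁)) ∂ν₁ t₂ :=
          integral_mono (hint hGU _) ((hint hG _).add (integrable_const _)) inner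
      _ = (∫ y₁, ∫ y₂, d y₁ y₂ t₂ ∂ν₂ t₂ ∂ν₁ t₂) + (η + Hc * (t₂ - t₁)) := by
          rw [integral_add (hint hG _) (integrable_const _), integral_const, probReal_univ, one_smul]
  -- `∫∫ U(t₂) dν₂(t₂) dν₁(t₂) = Σ (∫ αᵢ dν₁(t₁)) (∫ βᵢ dν₂(t₁))` (reproduction)
  have hrepA : ∀ i, ∫ y, A i y t₂ ∂ν₁ t₂ = ∫ y, α i y ∂ν₁ t₁ := by
    intro i
    simp only [hA, hν₁]
    rw [integral_heatKernelMeasure_trans hh hR h12.le h2.le x₁ (hαs i).continuous]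
    refine integral_congr_ae (Eventually.of_forall fun y ↦ ?_)
    simp only
    rw [integral_heatKernelMeasure hh hR h12 y (hαs i).continuous, heatValueC_eq_heatValue hh hR y (hαs i)]
  have hrepB : ∀ i, ∫ y, B i y t₂ ∂ν₂ t₂ = ∫ y, β i y ∂ν₂ t₁ := by
    intro i
    simp only [hB, hν₂]
    rw [integral_heatKernelMeasure_trans hh hR h12.le h2.le x₂ (hβs i).continuous]
    refine integral_congr_ae (Eventually.of_forall fun y ↦ ?_)
    simp only
    rw [integral_heatKernelMeasure hh hR h12 y (hβs i).continuous, heatValueC_eq_heatValue hh hR y (hβs i)]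
  have hAc : ∀ i, Continuous fun y ↦ A i y t₂ := fun i ↦ (hAx i t₂ h12.le).continuous
  have hBc : ∀ i, Continuous fun y ↦ B i y t₂ := fun i ↦ (hBy i t₂ h12.le).continuous
  have hI2 : ∫ y₁, ∫ y₂, U y₁ y₂ t₂ ∂ν₂ t₂ ∂ν₁ t₂ = ∑ i, (∫ y, α i y ∂ν₁ t₁) * ∫ y, β i y ∂ν₂ t₁ := by
    have inner : ∀ y₁, ∫ y₂, U y₁ y₂ t₂ ∂ν₂ t₂ = ∑ i, A i y₁ t₂ * ∫ y, β i y ∂ν₂ t₁ := by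
      intro y₁
      simp only [hU]
      rw [integral_finsetSum _ fun i _ ↦ (hint (hBc i) _).const_mul _]
      refine Finset.sum_congr rfl fun i _ ↦ ?_
      rw [integral_const_mul, hrepB i]
    simp_rw [inner]
    rw [integral_finsetSum _ fun i _ ↦ (hint (hAc i) _).mul_const _]
    refine Finset.sum_congr rfl fun i _ ↦ ?_
    rw [integral_mul_const, hrepA i]
  -- `Σ (∫ αᵢ dν₁(t₁)) (∫ βᵢ dν₂(t₁)) = ∫∫ Σ αᵢ βᵢ dν₂(t₁) dν₁(t₁) ≥ ∫∫ d_{t₁}² − η`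
  have hI3 : ∑ i, (∫ y, α i y ∂ν₁ t₁) * ∫ y, β i y ∂ν₂ t₁ =
      ∫ y₁, ∫ y₂, ∑ i, α i y₁ * β i y₂ ∂ν₂ t₁ ∂ν₁ t₁ := by
    have inner : ∀ y₁, ∫ y₂, ∑ i, α i y₁ * β i y₂ ∂ν₂ t₁ = ∑ i, α i y₁ * ∫ y, β i y ∂ν₂ t₁ := by
      intro y₁
      rw [integral_finsetSum _ fun i _ ↦ (hint (hβs i).continuous _).const_mul _]
      refine Finset.sum_congr rfl fun i _ ↦ ?_
      rw [integral_const_mul]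
    simp_rw [inner]
    rw [integral_finsetSum _ fun i _ ↦ (hint (hαs i).continuous _).mul_const _]
    refine Finset.sum_congr rfl fun i _ ↦ ?_
    rw [integral_mul_const]
  have hSc : Continuous fun q : M × M ↦ ∑ i, α i q.1 * β i q.2 :=
    continuous_finsetSum _ fun i _ ↦ ((hαs i).continuous.comp continuous_fst).mul
      ((hβs i).continuous.comp continuous_snd)
  have hI4 : (∫ y₁, ∫ y₂, d y₁ y₂ t₁ ∂ν₂ t₁ ∂ν₁ t₁) - η ≤
      ∫ y₁, ∫ y₂, ∑ i, α i y₁ * β i y₂ ∂ν₂ t₁ ∂ν₁ t₁ := by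
    have inner : ∀ y₁, (∫ y₂, d y₁ y₂ t₁ ∂ν₂ t₁) - η ≤ ∫ y₂, ∑ i, α i y₁ * β i y₂ ∂ν₂ t₁ := by
      intro y₁
      have hId : Integrable (fun y₂ ↦ d y₁ y₂ t₁) (ν₂ t₁) :=
        hint ((hdc t₁).comp (Continuous.prodMk_right y₁)) _
      calc (∫ y₂, d y₁ y₂ t₁ ∂ν₂ t₁) - η = ∫ y₂, d y₁ y₂ t₁ - η ∂ν₂ t₁ := by
            rw [integral_sub hId (integrable_const _), integral_const, probReal_univ, one_smul]
        _ ≤ ∫ y₂, ∑ i, α i y₁ * β i y₂ ∂ν₂ t₁ := by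
            refine integral_mono (hId.sub (integrable_const _))
              (hint (hSc.comp (Continuous.prodMk_right y₁)) _) fun y₂ ↦ ?_
            have := happrox (y₁, y₂)
            simp only [hd] at this ⊢
            linarith [(abs_lt.1 this).2]
    have hG : Continuous fun y₁ ↦ ∫ y₂, d y₁ y₂ t₁ ∂ν₂ t₁ :=
      Literature.MeasureTheory.Integral.continuous_integral_of_continuous_prod (ν₂ t₁) (hdc t₁)
    have hGS : Continuous fun y₁ ↦ ∫ y₂, ∑ i, α i y₁ * β i y₂ ∂ν₂ t₁ :=
      Literature.MeasureTheory.Integral.continuous_integral_of_continuous_prod (ν₂ t₁) hSc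
    calc (∫ y₁, ∫ y₂, d y₁ y₂ t₁ ∂ν₂ t₁ ∂ν₁ t₁) - η
        = ∫ y₁, (∫ y₂, d y₁ y₂ t₁ ∂ν₂ t₁) - η ∂ν₁ t₁ := by
          rw [integral_sub (hint hG _) (integrable_const _), integral_const, probReal_univ, one_smul]
      _ ≤ ∫ y₁, ∫ y₂, ∑ i, α i y₁ * β i y₂ ∂ν₂ t₁ ∂ν₁ t₁ :=
          integral_mono ((hint hG _).sub (integrable_const _)) (hint hGS _) inner
  -- assemble
  rw [hI2, hI3] at hI1
  linarith

end Directional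

end Literature.Geometry.Riemannian

end
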